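import Mathlib
import Summits.ValiantsHypothesis.ValiantsHypothesis.Theorems.FeketeSOSCharPSparseSOSStubDictionaryAtInfinity

/-!
# Crux `FeketeSOS.CharPSparseSOS` (stmt-ValiantsHypothesis-14989), line `Sketch` — stub `twoCuspJointSupport`

Joint two-cusp support bound: a non-zero polynomial `P` of degree `< p` over a field `K` of
characteristic `p` whose coefficient function is deep `≥ D` at the upper cusp (`(X - 1)^D ∣ P`) and
deep `≥ D` at the lower cusp (`P_0 = 0` and the top moments `Σ_{n<p} P_n n^{p-1-d}` vanish for
`1 ≤ d < D`) has at least `2D` monomials.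

Proof (Laurent–Vandermonde).  WLOG `1 ≤ D`.  Since `P ≠ 0` and `(X - 1)^D ∣ P`, `D ≤ deg P < p`, so
the dictionary at the upper cusp (`stub_dictionaryAtInfinity`) gives `Σ_{n<p} P_n n^a = 0` for
`a < D`.  Write `S = supp P ⊆ {1, …, p-1}` (`P_0 = 0`), `t = #S`, and suppose `t ≤ 2D - 1`.  For `n ∈ S`,
`(n : K)` is a non-zero element of the prime field, so `n^{p-1} = 1` (Frobenius fixes `ℕ`-casts).
Put `w_n = P_n n^{p-D}`.  For `e < t`: if `e ≤ D - 2`, `Σ_{n∈S} w_n n^e = Σ_n P_n n^{p-1-d}` with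
`d = D-1-e ∈ [1, D)`, a vanishing top moment; if `D - 1 ≤ e ≤ 2D - 2`, `n^{p-D+e} = n^{p-1} n^{e-D+1} =
n^{e-D+1}` with `e - D + 1 < D`, a vanishing upper-cusp moment.  So `Σ_{n∈S} w_n n^e = 0` for all
`e < t`; the nodes `(n : K)`, `n ∈ S`, are pairwise distinct (`CharP.natCast_injOn_Iio`), hence
Vandermonde (`Matrix.eq_zero_of_forall_pow_sum_mul_pow_eq_zero`) gives `w_n = 0`, so `P_n = 0` on
`S ≠ ∅` — absurd.
-/

-- `Summit.ValiantsHypothesis.ValiantsHypothesis.…` is the tree's mandated single-conjunct layout (Sub = Summit).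
set_option linter.dupNamespace false

namespace Summit.ValiantsHypothesis.ValiantsHypothesis.Theorems.CharPSparseSOSTwoCusp

open Polynomial Finset

/-- Fermat in the prime field of `K`: if `char K = p` is prime and `(n : K) ≠ 0` then
`(n : K)^(p-1) = 1` (the Frobenius `x ↦ x^p` fixes `ℕ`-casts). -/
theorem natCast_pow_char_sub_one_eq_one (K : Type*) [Field K] (p : ℕ) [Fact p.Prime] [CharP K p]
    (n : ℕ) (hn : (n : K) ≠ 0) : (n : K) ^ (p - 1) = 1 := by
  have h : (n : K) ^ p = n := by
    have := map_natCast (frobenius K p) n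
    rwa [frobenius_def] at this
  rw [← Nat.sub_add_cancel (Fact.out : p.Prime).one_le, pow_succ] at h
  exact (mul_eq_right₀ hn).mp h

/-- **Joint two-cusp support bound.** Over a field `K` of characteristic `p`, a non-zero `P : K[X]`
with `natDegree P < p`, `(X - 1)^D ∣ P`, `P.coeff 0 = 0` (when `1 ≤ D`) and vanishing top moments
`Σ_{n<p} P.coeff n * n^{p-1-d} = 0` for `1 ≤ d < D` has at least `2D` non-zero coefficients
(Vandermonde on the distinct non-zero nodes `(n : K)`, `n ∈ supp P`, with the `2D - 1` consecutive
Laurent exponents `-(D-1), …, D-1`). -/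
theorem twoCuspJointSupport :
    ∀ (K : Type) [Field K] (p : ℕ) [Fact p.Prime] [CharP K p] (P : K[X]) (D : ℕ),
      P ≠ 0 → P.natDegree < p → (X - C (1 : K)) ^ D ∣ P → (1 ≤ D → P.coeff 0 = 0) →
        (∀ d : ℕ, 1 ≤ d → d < D →
          ∑ n ∈ Finset.range p, P.coeff n * (n : K) ^ (p - 1 - d) = 0) →
          2 * D ≤ P.support.card := by
  intro K _ p _ _ P D hP hdeg hdvd h0 hmom
  classical
  by_contra hlt
  rw [not_le] at hlt
  -- `S = supp P` is non-empty, misses `0`, and sits inside `range p`; `1 ≤ D ≤ p`.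
  have hSne : P.support.Nonempty := by
    rw [Finset.nonempty_iff_ne_empty, Ne, Polynomial.support_eq_empty]
    exact hP
  have hD1 : 1 ≤ D := by omega
  have hDp : D ≤ p := by
    have h1 : ((X - C (1 : K)) ^ D).natDegree ≤ P.natDegree := natDegree_le_of_dvd hdvd hP
    rw [natDegree_pow, natDegree_X_sub_C, mul_one] at h1
    omega
  -- the upper-cusp moments, from the dictionary
  have hinf : ∀ a : ℕ, a < D → ∑ n ∈ range p, P.coeff n * (n : K) ^ a = 0 :=
    (stub_dictionaryAtInfinity K p P D hdeg hDp).mp hdvd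
  have hP0 : P.coeff 0 = 0 := h0 hD1
  have hSpos : ∀ n ∈ P.support, n ≠ 0 := by
    intro n hn h
    rw [h] at hn
    exact (mem_support_iff.mp hn) hP0
  have hSlt : ∀ n ∈ P.support, n < p := fun n hn =>
    lt_of_le_of_lt (le_natDegree_of_mem_supp n hn) hdeg
  have hSsub : P.support ⊆ range p := fun n hn => mem_range.mpr (hSlt n hn)
  have hcast : ∀ n ∈ P.support, (n : K) ≠ 0 := by
    intro n hn h
    rw [CharP.cast_eq_zero_iff K p] at h
    exact absurd (Nat.le_of_dvd (Nat.pos_of_ne_zero (hSpos n hn)) h) (not_le.mpr (hSlt n hn))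
  have hferm : ∀ n ∈ P.support, (n : K) ^ (p - 1) = 1 := fun n hn =>
    natCast_pow_char_sub_one_eq_one K p n (hcast n hn)
  -- The `2D - 1` consecutive moments, restricted to the support and re-centred:
  -- `Σ_{n∈S} (P_n n^{p-D}) n^e = 0` for `e < t ≤ 2D - 1`.
  have hmomS : ∀ e : ℕ, e < P.support.card →
      ∑ n ∈ P.support, P.coeff n * (n : K) ^ (p - D) * (n : K) ^ e = 0 := by
    intro e he
    rcases lt_or_ge e (D - 1) with he1 | he1
    · -- a top moment, `d = D - 1 - e ∈ [1, D)`
      have h1 := hmom (D - 1 - e) (by omega) (by omega)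
      rw [← sum_subset hSsub (fun n _ hn => by rw [notMem_support_iff.mp hn, zero_mul])] at h1
      rw [← h1]
      refine sum_congr rfl fun n _ => ?_
      rw [mul_assoc, ← pow_add]
      congr 2
      omega
    · -- an upper-cusp moment, `a = e - (D - 1) ∈ [0, D)`, via `n^{p-1} = 1`
      have h1 := hinf (e - (D - 1)) (by omega)
      rw [← sum_subset hSsub (fun n _ hn => by rw [notMem_support_iff.mp hn, zero_mul])] at h1
      rw [← h1]
      refine sum_congr rfl fun n hn => ?_
      rw [mul_assoc, ← pow_add]
      congr 1
      have hexp : p - D + e = (p - 1) + (e - (D - 1)) := by omega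
      rw [hexp, pow_add, hferm n hn, one_mul]
  -- Index the support by `Fin t` and apply the Vandermonde kernel lemma.
  set t := P.support.card
  let eqv : P.support ≃ Fin t := P.support.equivFin
  let node : Fin t → ℕ := fun j => (eqv.symm j : ℕ)
  have hnode_mem : ∀ j, node j ∈ P.support := fun j => (eqv.symm j).2
  have hnode_inj : Function.Injective node := fun i j h =>
    eqv.symm.injective (Subtype.ext h)
  let f : Fin t → K := fun j => (node j : K)
  let v : Fin t → K := fun j => P.coeff (node j) * (node j : K) ^ (p - D)
  have hf : Function.Injective f := fun i j h =>
    hnode_inj (CharP.natCast_injOn_Iio K p (hSlt _ (hnode_mem i)) (hSlt _ (hnode_mem j)) h)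
  have hv : v = 0 := by
    refine Matrix.eq_zero_of_forall_pow_sum_mul_pow_eq_zero hf fun i => ?_
    rw [← hmomS i i.isLt, ← sum_coe_sort P.support]
    exact eqv.symm.sum_comp
      (fun s : P.support => P.coeff (s : ℕ) * ((s : ℕ) : K) ^ (p - D) * ((s : ℕ) : K) ^ (i : ℕ))
  obtain ⟨n0, hn0⟩ := hSne
  have h2 := congr_fun hv (eqv ⟨n0, hn0⟩)
  simp only [v, node, Equiv.symm_apply_apply, Pi.zero_apply] at h2
  rcases mul_eq_zero.mp h2 with h | h
  · exact (mem_support_iff.mp hn0) h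
  · exact hcast n0 hn0 (pow_eq_zero_iff'.mp h).1

end Summit.ValiantsHypothesis.ValiantsHypothesis.Theorems.CharPSparseSOSTwoCusp
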